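import Literature.RingTheory.FormalGroups.FormalGroupCoefficients
import Mathlib.RingTheory.Ideal.Quotient.Operations
import HarnessLib

/-!
# The Lazard ring and the universal one-dimensional commutative formal group law
# ([Lazard1955] §II; [Hazewinkel1978] §1.1, §5.1)

Topic `Literature/RingTheory/FormalGroups`; namespace `Literature.RingTheory.FormalGroups`.  DEFINITIONS + fully proved
theorems; no named fact, no instance, no notation, no `sorry`.

The CARRIER of a law is Mathlib's `FormalGroup R` (`Mathlib.RingTheory.FormalGroup.Basic`).  This file constructs the
**Lazard ring** `LazardRing` — the quotient of the free commutative ring `ℤ[a_d : d ∈ ℕ²]` on the would-be coefficients of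
a law `F(X,Y) = X + Y + Σ_{d interior} a_d X^{d₀} Y^{d₁}` by the ideal generated by the coefficients of the associator
`F(F(X,Y),Z) − F(X,F(Y,Z))`, by the commutativity relations `a_d − a_{d̄}` and by the idle variables `a_d` (`d` not
interior, i.e. `d₀ = 0` or `d₁ = 0`) — together with the **universal commutative law** `LazardRing.univLaw` over it and its
universal property: commutative one-dimensional formal group laws over `B` correspond to ring maps `LazardRing →+* B`
(`LazardRing.lift`, `LazardRing.map_univLaw_lift`, `LazardRing.hom_ext`).  That `LazardRing` is a polynomial ring
(Lazard's theorem) is NOT in this file (see `LazardRingPolynomial`).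

## Contents
* (coefficients of a law: sibling `FormalGroupCoefficients` — `coeff_formalGroup_of_not_interior`, `coeff_swapIdx_formalGroup`.)
* §2 the associator `assocDiff F` of a two-variable series and its base change `assocDiff_map`.
* §3 the generic law `genericLaw` over `LazardGen = MvPolynomial (Fin 2 →₀ ℕ) ℤ`, the relations, `lazardIdeal`,
  `LazardRing`, the universal law `LazardRing.univLaw` (a commutative `FormalGroup`).
* §4 universality: `LazardRing.lift G : LazardRing →+* B` with `univLaw.map (lift G) = G`, and `hom_ext`.

## References
* [Lazard1955] M. Lazard, *Sur les groupes de Lie formels à un paramètre*, Bull. SMF 83 (1955), §II.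
* [Hazewinkel1978] M. Hazewinkel, *Formal Groups and Applications* (1978), §1.1, §5.1.
-/

noncomputable section

namespace Literature.RingTheory.FormalGroups

open _root_.MvPowerSeries (HasSubst subst coeff)

universe u v

variable {R : Type u} [CommRing R] {S : Type v} [CommRing S]

/-! ## §2 The associator of a two-variable series and its base change -/

/-- The **associator** `F(F(X,Y),Z) − F(X,F(Y,Z))` of a two-variable series `F` (a three-variable series); a one-dimensional
formal group law is exactly an `F ≡ X + Y (mod deg 2)` with vanishing associator. [cite: Hazewinkel1978, §1.1 (1.1.1)] -/
def assocDiff (F : MvPowerSeries (Fin 2) R) : MvPowerSeries (Fin 3) R :=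
  F.subst ![F.subst ![MvPowerSeries.X 0, MvPowerSeries.X 1], MvPowerSeries.X 2] -
    F.subst ![MvPowerSeries.X 0, F.subst ![MvPowerSeries.X 1, MvPowerSeries.X 2]]

/-- Mapping both entries of a pair (plumbing). [folklore] -/
private theorem map_pair {τ : Type*} (h : R →+* S) (u v : MvPowerSeries τ R) :
    (fun s => MvPowerSeries.map h ((![u, v] : Fin 2 → MvPowerSeries τ R) s)) =
      ![MvPowerSeries.map h u, MvPowerSeries.map h v] := by
  funext s; fin_cases s <;> simp

/-- Base change of the left bracketing: `h_*(F(F(X,Y),Z)) = (h_*F)((h_*F)(X,Y),Z)` (`F(0,0) = 0`).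
[cite: Hazewinkel1978, §1.1 (1.1.6)] -/
theorem map_subst_subst_left (h : R →+* S) (F : MvPowerSeries (Fin 2) R) (hF : F.constantCoeff = 0) :
    MvPowerSeries.map h (F.subst ![F.subst ![MvPowerSeries.X 0, MvPowerSeries.X 1], MvPowerSeries.X 2]) =
      (F.map h).subst ![(F.map h).subst ![(MvPowerSeries.X 0 : MvPowerSeries (Fin 3) S), MvPowerSeries.X 1],
        MvPowerSeries.X 2] := by
  rw [MvPowerSeries.map_subst (HasSubst.cons_subst_zero_left (0 : Fin 3) 1 2 hF), map_pair,
    MvPowerSeries.map_subst HasSubst.X_X, map_pair, MvPowerSeries.map_X, MvPowerSeries.map_X, MvPowerSeries.map_X]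

/-- Base change of the right bracketing: `h_*(F(X,F(Y,Z))) = (h_*F)(X,(h_*F)(Y,Z))` (`F(0,0) = 0`).
[cite: Hazewinkel1978, §1.1 (1.1.6)] -/
theorem map_subst_subst_right (h : R →+* S) (F : MvPowerSeries (Fin 2) R) (hF : F.constantCoeff = 0) :
    MvPowerSeries.map h (F.subst ![MvPowerSeries.X 0, F.subst ![MvPowerSeries.X 1, MvPowerSeries.X 2]]) =
      (F.map h).subst ![(MvPowerSeries.X 0 : MvPowerSeries (Fin 3) S),
        (F.map h).subst ![(MvPowerSeries.X 1 : MvPowerSeries (Fin 3) S), MvPowerSeries.X 2]] := by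
  rw [MvPowerSeries.map_subst (HasSubst.cons_subst_zero_right (0 : Fin 3) 1 2 hF), map_pair,
    MvPowerSeries.map_subst HasSubst.X_X, map_pair, MvPowerSeries.map_X, MvPowerSeries.map_X, MvPowerSeries.map_X]

/-- **The associator commutes with base change**: `assocDiff (h_* F) = h_* (assocDiff F)` (`F(0,0) = 0`).
[cite: Hazewinkel1978, §1.1 (1.1.6)] -/
theorem assocDiff_map (h : R →+* S) (F : MvPowerSeries (Fin 2) R) (hF : F.constantCoeff = 0) :
    assocDiff (F.map h) = MvPowerSeries.map h (assocDiff F) := by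
  rw [assocDiff, assocDiff, map_sub, map_subst_subst_left h F hF, map_subst_subst_right h F hF]

/-- A law has vanishing associator. [cite: Hazewinkel1978, §1.1 (1.1.1)] -/
theorem assocDiff_formalGroup (G : FormalGroup R) : assocDiff G.toPowerSeries = 0 := by
  rw [assocDiff, sub_eq_zero]
  exact G.assoc

/-! ## §3 The generic law, the Lazard ideal, the Lazard ring and the universal law -/

/-- The free coefficient ring `ℤ[a_d : d ∈ ℕ²]` of the generic two-variable series (one variable `a_d` for every
exponent `d : Fin 2 →₀ ℕ`; the non-interior ones are idle). [cite: Lazard1955, §II] -/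
abbrev LazardGen : Type := MvPolynomial (Fin 2 →₀ ℕ) ℤ

/-- The **generic series** `F_gen(X,Y) = X + Y + Σ_{d interior} a_d X^{d₀} Y^{d₁}` over `ℤ[a]` (interior: `d₀, d₁ > 0`).
[cite: Lazard1955, §II] -/
def genericLaw : MvPowerSeries (Fin 2) LazardGen := fun d =>
  if 0 < d 0 ∧ 0 < d 1 then MvPolynomial.X d
  else if d = Finsupp.single 0 1 ∨ d = Finsupp.single 1 1 then 1 else 0

/-- Coefficients of the generic series. [cite: Lazard1955, §II] -/
theorem coeff_genericLaw (d : Fin 2 →₀ ℕ) : coeff d genericLaw =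
    if 0 < d 0 ∧ 0 < d 1 then MvPolynomial.X d
    else if d = Finsupp.single 0 1 ∨ d = Finsupp.single 1 1 then 1 else 0 := rfl

/-- Interior coefficients of the generic series are the variables `a_d`. [cite: Lazard1955, §II] -/
theorem coeff_genericLaw_of_interior {d : Fin 2 →₀ ℕ} (hd : 0 < d 0 ∧ 0 < d 1) :
    coeff d genericLaw = MvPolynomial.X d := by
  rw [coeff_genericLaw, if_pos hd]

/-- The generic series has no constant term. [cite: Lazard1955, §II] -/
theorem constantCoeff_genericLaw : MvPowerSeries.constantCoeff genericLaw = 0 := by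
  rw [← MvPowerSeries.coeff_zero_eq_constantCoeff_apply, coeff_genericLaw]
  have h0 : ¬((0 : Fin 2 →₀ ℕ) = Finsupp.single 0 1 ∨ (0 : Fin 2 →₀ ℕ) = Finsupp.single 1 1) := by
    rintro (h | h)
    · have := congrArg (fun e => e 0) h
      simp at this
    · have := congrArg (fun e => e 1) h
      simp at this
  simp [h0]

/-- The generic series has linear part `X + Y`: coefficient of `X`. [cite: Lazard1955, §II] -/
theorem coeff_genericLaw_single_zero : coeff (Finsupp.single 0 1) genericLaw = 1 := by
  rw [coeff_genericLaw]; simp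

/-- The generic series has linear part `X + Y`: coefficient of `Y`. [cite: Lazard1955, §II] -/
theorem coeff_genericLaw_single_one : coeff (Finsupp.single 1 1) genericLaw = 1 := by
  rw [coeff_genericLaw]; simp [Finsupp.single_eq_single_iff]

/-- **The Lazard relations**: the idle variables `a_d` (`d` not interior), the commutativity relations `a_d − a_{d̄}`,
and every coefficient of the associator of the generic series. [cite: Lazard1955, §II] -/
def lazardRelations : Set LazardGen :=
  {x | ∃ d : Fin 2 →₀ ℕ, ¬(0 < d 0 ∧ 0 < d 1) ∧ x = MvPolynomial.X d} ∪
    ({x | ∃ d : Fin 2 →₀ ℕ, x = MvPolynomial.X d - MvPolynomial.X (swapIdx d)} ∪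
      {x | ∃ n : Fin 3 →₀ ℕ, x = coeff n (assocDiff genericLaw)})

/-- **The Lazard ideal** `I ⊆ ℤ[a]`, generated by the Lazard relations. [cite: Lazard1955, §II] -/
def lazardIdeal : Ideal LazardGen := Ideal.span lazardRelations

/-- Idle variables are relations. [cite: Lazard1955, §II] -/
theorem X_mem_lazardIdeal_of_not_interior {d : Fin 2 →₀ ℕ} (hd : ¬(0 < d 0 ∧ 0 < d 1)) :
    (MvPolynomial.X d : LazardGen) ∈ lazardIdeal :=
  Ideal.subset_span (Or.inl ⟨d, hd, rfl⟩)

/-- Commutativity relations are relations. [cite: Lazard1955, §II] -/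
theorem X_sub_X_swapIdx_mem_lazardIdeal (d : Fin 2 →₀ ℕ) :
    (MvPolynomial.X d - MvPolynomial.X (swapIdx d) : LazardGen) ∈ lazardIdeal :=
  Ideal.subset_span (Or.inr (Or.inl ⟨d, rfl⟩))

/-- Associator coefficients are relations. [cite: Lazard1955, §II] -/
theorem coeff_assocDiff_genericLaw_mem_lazardIdeal (n : Fin 3 →₀ ℕ) :
    coeff n (assocDiff genericLaw) ∈ lazardIdeal :=
  Ideal.subset_span (Or.inr (Or.inr ⟨n, rfl⟩))

/-- **The Lazard ring** `L = ℤ[a] ⧸ I`: the universal coefficient ring of commutative one-dimensional formal group laws.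
[cite: Lazard1955, §II] -/
abbrev LazardRing : Type := LazardGen ⧸ lazardIdeal

namespace LazardRing

/-- The class `ā_d ∈ L` of the generic coefficient `a_d`. [cite: Lazard1955, §II] -/
def gen (d : Fin 2 →₀ ℕ) : LazardRing := Ideal.Quotient.mk lazardIdeal (MvPolynomial.X d)

/-- Idle generators vanish in `L`. [cite: Lazard1955, §II] -/
theorem gen_of_not_interior {d : Fin 2 →₀ ℕ} (hd : ¬(0 < d 0 ∧ 0 < d 1)) : gen d = 0 :=
  (Ideal.Quotient.eq_zero_iff_mem).mpr (X_mem_lazardIdeal_of_not_interior hd)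

/-- Generators are symmetric in `L`: `ā_{d̄} = ā_d`. [cite: Lazard1955, §II] -/
theorem gen_swapIdx (d : Fin 2 →₀ ℕ) : gen (swapIdx d) = gen d := by
  rw [eq_comm, gen, gen, Ideal.Quotient.eq]
  exact X_sub_X_swapIdx_mem_lazardIdeal d

/-- The series of the universal law: the generic series read in `L`. [cite: Lazard1955, §II] -/
def univSeries : MvPowerSeries (Fin 2) LazardRing :=
  MvPowerSeries.map (Ideal.Quotient.mk lazardIdeal) genericLaw

/-- Coefficients of the universal series: `ā_d` at interior `d`, `X + Y` in degree one, `0` elsewhere.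
[cite: Lazard1955, §II] -/
theorem coeff_univSeries (d : Fin 2 →₀ ℕ) : coeff d univSeries =
    if 0 < d 0 ∧ 0 < d 1 then gen d else if d = Finsupp.single 0 1 ∨ d = Finsupp.single 1 1 then 1 else 0 := by
  rw [univSeries, MvPowerSeries.coeff_map, coeff_genericLaw]
  split_ifs <;> simp [gen]

/-- The associator of the universal series vanishes (its coefficients are the associator relations, read in `L`).
[cite: Lazard1955, §II] -/
theorem assocDiff_univSeries : assocDiff univSeries = 0 := by
  rw [univSeries, assocDiff_map _ _ constantCoeff_genericLaw]
  ext n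
  rw [MvPowerSeries.coeff_map, map_zero, Ideal.Quotient.eq_zero_iff_mem]
  exact coeff_assocDiff_genericLaw_mem_lazardIdeal n

/-- **The universal commutative one-dimensional formal group law** `F_univ` over the Lazard ring. [cite: Lazard1955, §II] -/
def univLaw : FormalGroup LazardRing where
  toPowerSeries := univSeries
  zero_constantCoeff := by
    rw [univSeries, MvPowerSeries.constantCoeff_map, constantCoeff_genericLaw, map_zero]
  lin_coeff_X := by rw [univSeries, MvPowerSeries.coeff_map, coeff_genericLaw_single_zero, map_one]
  lin_coeff_Y := by rw [univSeries, MvPowerSeries.coeff_map, coeff_genericLaw_single_one, map_one]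
  assoc := sub_eq_zero.mp assocDiff_univSeries

/-- The series of the universal law (unfolding). [cite: Lazard1955, §II] -/
@[simp] theorem univLaw_toPowerSeries : univLaw.toPowerSeries = univSeries := rfl

/-- **The universal law is commutative.** [cite: Lazard1955, §II] -/
theorem univLaw_isComm : univLaw.IsComm := by
  refine ⟨?_⟩
  ext d
  change coeff d univSeries = coeff d (univSeries.subst ![MvPowerSeries.X 1, MvPowerSeries.X 0])
  rw [coeff_subst_swap, coeff_univSeries, coeff_univSeries]
  by_cases hd : 0 < d 0 ∧ 0 < d 1
  · have hd' : 0 < swapIdx d 0 ∧ 0 < swapIdx d 1 := by simpa [and_comm] using hd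
    rw [if_pos hd, if_pos hd', gen_swapIdx]
  · have hd' : ¬(0 < swapIdx d 0 ∧ 0 < swapIdx d 1) := by simpa [and_comm] using hd
    rw [if_neg hd, if_neg hd']
    have hsw : ∀ i j : Fin 2, swapIdx d = Finsupp.single i 1 ↔ d = swapIdx (Finsupp.single i 1) := by
      intro i j
      constructor
      · intro h; rw [← h, swapIdx_swapIdx]
      · intro h; rw [h, swapIdx_swapIdx]
    have h0 : swapIdx (Finsupp.single (0 : Fin 2) 1) = Finsupp.single 1 1 := by
      ext i; fin_cases i <;> simp
    have h1 : swapIdx (Finsupp.single (1 : Fin 2) 1) = Finsupp.single 0 1 := by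
      ext i; fin_cases i <;> simp
    simp only [hsw 0 0, hsw 1 1, h0, h1, or_comm]

/-! ## §4 Universality -/

variable {B : Type u} [CommRing B]

/-- The values of the generic coefficients on a law `G`: `a_d ↦ coeff_d G` at interior `d`, `a_d ↦ 0` at idle `d`.
[cite: Lazard1955, §II] -/
def coeffVal (G : FormalGroup B) (d : Fin 2 →₀ ℕ) : B :=
  if 0 < d 0 ∧ 0 < d 1 then coeff d G.toPowerSeries else 0

/-- The classifying map on the free ring: `ℤ[a] → B`, `a_d ↦ coeffVal G d`. [cite: Lazard1955, §II] -/
def liftGen (G : FormalGroup B) : LazardGen →+* B :=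
  MvPolynomial.eval₂Hom (Int.castRingHom B) (coeffVal G)

/-- `liftGen G (a_d) = coeffVal G d`. [cite: Lazard1955, §II] -/
@[simp] theorem liftGen_X (G : FormalGroup B) (d : Fin 2 →₀ ℕ) :
    liftGen G (MvPolynomial.X d) = coeffVal G d := by
  simp [liftGen]

/-- **The generic series specialises to `G`** under `a_d ↦ coeff_d G`. [cite: Lazard1955, §II] -/
theorem map_liftGen_genericLaw (G : FormalGroup B) :
    MvPowerSeries.map (liftGen G) genericLaw = G.toPowerSeries := by
  ext d
  rw [MvPowerSeries.coeff_map, coeff_genericLaw]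
  by_cases hd : 0 < d 0 ∧ 0 < d 1
  · rw [if_pos hd, liftGen_X, coeffVal, if_pos hd]
  · rw [if_neg hd, coeff_formalGroup_of_not_interior G hd]
    split_ifs <;> simp

/-- The classifying map kills the Lazard relations. [cite: Lazard1955, §II] -/
theorem liftGen_eq_zero_of_mem (G : FormalGroup B) [G.IsComm] {x : LazardGen} (hx : x ∈ lazardIdeal) :
    liftGen G x = 0 := by
  refine (Ideal.span_le (I := RingHom.ker (liftGen G))).mpr ?_ hx
  rintro x (⟨d, hd, rfl⟩ | ⟨d, rfl⟩ | ⟨n, rfl⟩)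
  · rw [SetLike.mem_coe, RingHom.mem_ker, liftGen_X, coeffVal, if_neg hd]
  · rw [SetLike.mem_coe, RingHom.mem_ker, map_sub, liftGen_X, liftGen_X, coeffVal, coeffVal, sub_eq_zero]
    by_cases hd : 0 < d 0 ∧ 0 < d 1
    · have hd' : 0 < swapIdx d 0 ∧ 0 < swapIdx d 1 := by simpa [and_comm] using hd
      rw [if_pos hd, if_pos hd', coeff_swapIdx_formalGroup]
    · have hd' : ¬(0 < swapIdx d 0 ∧ 0 < swapIdx d 1) := by simpa [and_comm] using hd
      rw [if_neg hd, if_neg hd']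
  · rw [SetLike.mem_coe, RingHom.mem_ker, ← MvPowerSeries.coeff_map, ← assocDiff_map _ _ constantCoeff_genericLaw,
      map_liftGen_genericLaw, assocDiff_formalGroup, MvPowerSeries.coeff_zero]

/-- **The classifying map** `L →+* B` of a commutative law `G` over `B`. [cite: Lazard1955, §II Thm. II] -/
def lift (G : FormalGroup B) [G.IsComm] : LazardRing →+* B :=
  Ideal.Quotient.lift lazardIdeal (liftGen G) (fun _ hx => liftGen_eq_zero_of_mem G hx)

/-- `lift G (ā_d) = coeffVal G d`. [cite: Lazard1955, §II Thm. II] -/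
@[simp] theorem lift_gen (G : FormalGroup B) [G.IsComm] (d : Fin 2 →₀ ℕ) : lift G (gen d) = coeffVal G d := by
  rw [lift, gen, Ideal.Quotient.lift_mk, liftGen_X]

/-- **Universality, existence: the universal law specialises to `G` under its classifying map**, `(lift G)_* F_univ = G`.
[cite: Lazard1955, §II Thm. II] -/
theorem map_univLaw_lift (G : FormalGroup B) [G.IsComm] : univLaw.map (lift G) = G := by
  apply FormalGroup.ext
  change MvPowerSeries.map (lift G) univSeries = G.toPowerSeries
  rw [univSeries, MvPowerSeries.map_map]
  have : (lift G).comp (Ideal.Quotient.mk lazardIdeal) = liftGen G := by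
    ext x <;> simp [lift, liftGen]
  rw [this, map_liftGen_genericLaw]

/-- A ring map out of `L` is determined by the law it classifies: its value on `ā_d` is the `d`-th coefficient of
`f_* F_univ` at interior `d` (and `0` at idle `d`). [cite: Lazard1955, §II Thm. II] -/
theorem apply_gen_eq_coeff (f : LazardRing →+* B) {d : Fin 2 →₀ ℕ} (hd : 0 < d 0 ∧ 0 < d 1) :
    f (gen d) = coeff d (univLaw.map f).toPowerSeries := by
  change f (gen d) = coeff d (MvPowerSeries.map f univSeries)
  rw [MvPowerSeries.coeff_map, coeff_univSeries, if_pos hd]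

/-- **Universality, uniqueness: two ring maps out of `L` classifying the same law are equal.** [cite: Lazard1955, §II Thm. II] -/
theorem hom_ext {f g : LazardRing →+* B} (h : univLaw.map f = univLaw.map g) : f = g := by
  apply Ideal.Quotient.ringHom_ext
  refine MvPolynomial.ringHom_ext (fun n => by simp) (fun d => ?_)
  change f (gen d) = g (gen d)
  by_cases hd : 0 < d 0 ∧ 0 < d 1
  · rw [apply_gen_eq_coeff f hd, apply_gen_eq_coeff g hd, h]
  · rw [gen_of_not_interior hd, map_zero, map_zero]

/-- `lift` of the universal law itself is the identity. [cite: Lazard1955, §II Thm. II] -/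
theorem lift_univLaw : @lift _ _ univLaw univLaw_isComm = RingHom.id LazardRing := by
  haveI := univLaw_isComm
  apply hom_ext
  rw [map_univLaw_lift]
  apply FormalGroup.ext
  change univSeries = MvPowerSeries.map (RingHom.id _) univSeries
  rw [MvPowerSeries.map_id]
  rfl

/-- **Naturality of `lift`**: `lift (h_* G) = h ∘ lift G`. [cite: Lazard1955, §II Thm. II] -/
theorem lift_map (G : FormalGroup B) [G.IsComm] {C : Type v} [CommRing C] (h : B →+* C) [(G.map h).IsComm] :
    lift (G.map h) = h.comp (lift G) := by
  apply Ideal.Quotient.ringHom_ext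
  refine MvPolynomial.ringHom_ext (fun n => by simp) (fun d => ?_)
  change lift (G.map h) (gen d) = h (lift G (gen d))
  rw [lift_gen, lift_gen, coeffVal, coeffVal]
  split_ifs with hd
  · simp
  · simp

end LazardRing

end Literature.RingTheory.FormalGroups
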